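import Literature.NumberTheory.Rogawski1990.ArchOrbFamGExtJumpWall02Dress   -- ★ p851103 (F0P3a-p08 lineage): `smul_coe_conj_cayleyTorus` (the centre of `U(J)` is a scalar on the Cayley torus); brings ★ `ArchInnerFormChartLocal` (`gprimeBlockAt`), ★ `cayley_conj_circleDiagonal_mem_of_eq_over`
import Literature.NumberTheory.Automorphic.ArchInnerFormChartLocal          -- ★ `gprimeBlockAt` (the local chart torus point)
import HarnessLib

/-!
# (S-ad) THE «(M2) ⇒ DESC» ADAPTER: centre absorption on the Cayley torus turns the one-place parametric box descent with the RAW torus point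
# `P·diag(e^{ic₀}, e^{ic₂})·P⁻¹` into the NORMALISED form `P·diag(e^{iψ}, e^{−iψ})·P⁻¹`, `ψ = (c₀ − c₂)∕2`, consumed by the face-descent tower (Rogawski 1990 §8.2; Varadarajan 1977 I §3)

Topic `NumberTheory/Rogawski1990`; namespace `Literature.NumberTheory.Rogawski1990`.  THEOREMS ONLY (no `def`, no instance, no notation, no axiom, no named fact, no `sorry`).
Cell `pub/hodgecm-mathlib`, crux H413 (`stmt-HodgeConjecture-24833`), F0∕P3c line LH3 (closer stub `stub_N9`, DIRECT ROAD `F0_P3c_StubN9Direct`, LEAF v9), organ O-L1d′-N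
«MIXED SCALAR CORNERS, (0,2)-normalised» (`hCm`): sliver **(S-ad)** of F0P3a-p08 (g23)'s closer plan (2026-09-02T12:32:00Z; dealer LH3-plan (g4) default 12:32:12Z), seat
F0P3a-p05 (g21).  Count-neutral bookkeeping: nothing here closes an organ.

THE MATHEMATICS.  Leg (M2) (LH3-p04 (g4), `exists_descent_box_localOrbitalIntegral_param`) descends, at a face place `w ∉ S′` and near a base point `pw` on the `(0,2)`-wall, the
whole-group orbital integral `∫_{G_w} Θ(π, ↑↑(g γ_w(cw) g⁻¹)) dν_w` of a global `C^∞`, uniformly compactly supported matrix family `Θ` (parameter `π`) to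
`K · ∫_{U(J)} f((π, cw), ↑↑(h · P diag(e^{icw₀}, e^{icw₂}) P⁻¹ · h⁻¹)) dμ₀` (`K ∈ ℂˣ`, `f` global `C^∞` with one compact `M₂(ℂ)`-support, zero propagation
`Θ(π, ·) ≡ 0 ⇒ f((π, cw), ·) ≡ 0`).  The face-descent tower ★ `exists_faceDescentTower` (F0P3a-p08 (g23), p851446) consumes the NORMALISED schema DESC: a REAL constant acting by `•`
and the torus point `P diag(e^{iψ}, e^{−iψ}) P⁻¹`, `ψ = (cw₀ − cw₂)∕2`.  Since `diag(e^{icw₀}, e^{icw₂}) = e^{i(cw₀+cw₂)∕2} · diag(e^{iψ}, e^{−iψ})` and the centre of `U(J)` acts on the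
Cayley torus point by the scalar `e^{i(cw₀+cw₂)∕2}` (★ `smul_coe_conj_cayleyTorus`), the adapter is: `K′ := 1`, `U′ := U`,
`f′((q, cw), Y) := K · f((q, cw), e^{i(cw₀+cw₂)∕2} • Y)`, `C″ := {ζ⁻¹ • Y ∣ ζ ∈ S¹, Y ∈ C′}` (compact: continuous image of `S¹ × C′`).
* **`exists_desc_of_localDescent`** — the (M2) pieces `K hU hpw hf hC′ hfC′ hZ hI` (`K ≠ 0` not needed) (as separate hypotheses, so the conjunct order of the (M2) head is immaterial) imply DESC's
  conclusion at `(w, pw)` token for token (the per-face hypothesis `hdesc` of ★ `exists_faceDescentTower`).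
HONEST LABEL: HC_CM is proved only modulo the 7 printed citations (2 remaining: hLiu418 = `stmt-HodgeConjecture-24832`, h413 = `stmt-HodgeConjecture-24833`) until rung 0
closes; this file moves no row of the books.

## References
* [Rogawski1990] J. D. Rogawski, *Automorphic Representations of Unitary Groups in Three Variables*, Ann. of Math. Stud. 123 (1990), §8.2 pp. 119–122 (the centre acts by a
  scalar; orbital integrals near singular elliptic elements).
* [Varadarajan1977] V. S. Varadarajan, *Harmonic Analysis on Real Reductive Groups*, LNM 576 (1977), Part I §3 (descent to the centraliser).
-/

set_option autoImplicit false

noncomputable section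

open MeasureTheory MeasureTheory.Measure NumberField NumberField.InfinitePlace Matrix Complex Set Filter Topology
open scoped MatrixGroups Matrix Real Classical ENNReal NNReal ContDiff Matrix.Norms.Operator
open Literature.NumberTheory.Automorphic Literature.NumberTheory.Automorphic.UnitaryGroup Literature.NumberTheory.Automorphic.ArchCartan
open Literature.MeasureTheory.Group

namespace Literature.NumberTheory.Rogawski1990

section Adapter

variable {J : Matrix (Fin 2) (Fin 2) ℂ} (hJ : J = (StdForm.antidiagonal 2).over ℂ)
  [MeasurableSpace ↥(unitaryGroupOfForm (starRingEnd ℂ) J)] [BorelSpace ↥(unitaryGroupOfForm (starRingEnd ℂ) J)]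
  (μ₀ : Measure ↥(unitaryGroupOfForm (starRingEnd ℂ) J))
  (L : Type) [Field L] [NumberField L] [IsCMField L] (α : Fin 3 → L) (S' : Finset {w : InfinitePlace L // IsComplex w})
  (w : {w : InfinitePlace L // IsComplex w})
  [MeasurableSpace ↥(archLocal L 3 (Matrix.diagonal α) w)] [BorelSpace ↥(archLocal L 3 (Matrix.diagonal α) w)]
  (νw : Measure ↥(archLocal L 3 (Matrix.diagonal α) w))
  {P : Type} [NormedAddCommGroup P] [NormedSpace ℝ P]

omit [BorelSpace ↥(unitaryGroupOfForm (starRingEnd ℂ) J)] [NumberField L] [IsCMField L] [BorelSpace ↥(archLocal L 3 (Matrix.diagonal α) w)] in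
include hJ in
/-- **(S-ad) THE «(M2) ⇒ DESC» ADAPTER.**  From the pieces of the one-place parametric box descent at the face place `w` with base angles `pw` — a constant `K` in `ℂ` (its
non-vanishing is NOT needed), an open `U ∋ pw`, a global `C^∞` family `f : (P × ℝ³) × M₂(ℂ) → ℂ` with ONE compact matrix support `C′`, the zero-propagation clause `hZ`, and the identity `hI` with the RAW Cayley
torus point `P diag(e^{icw₀}, e^{icw₂}) P⁻¹` — to the NORMALISED schema DESC consumed by ★ `exists_faceDescentTower` (real constant `1` acting by `•`, torus point
`P diag(e^{iψ}, e^{−iψ}) P⁻¹`, `ψ = (cw₀ − cw₂)∕2`): `f′((q,cw), Y) := K · f((q,cw), e^{i(cw₀+cw₂)∕2} • Y)`, `C″ := {ζ⁻¹ • Y ∣ ζ ∈ S¹, Y ∈ C′}`; the two integrands agree by centre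
absorption ★ `smul_coe_conj_cayleyTorus` and `e^{i(cw₀+cw₂)∕2} e^{±iψ} = e^{icw₀}, e^{icw₂}`. [cite: Rogawski1990, §8.2 pp. 119–122] [cite: Varadarajan1977, Part I §3] -/
theorem exists_desc_of_localDescent (Θ : P × Matrix (Fin 3) (Fin 3) ℂ → ℂ) (K : ℂ) {U : Set (Fin 3 → ℝ)} (hU : IsOpen U)
    {pw : Fin 3 → ℝ} (hpw : pw ∈ U) {f : (P × (Fin 3 → ℝ)) × Matrix (Fin 2) (Fin 2) ℂ → ℂ} (hf : ContDiff ℝ ∞ f)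
    {C' : Set (Matrix (Fin 2) (Fin 2) ℂ)} (hC' : IsCompact C') (hfC' : ∀ (q : P × (Fin 3 → ℝ)) (X : Matrix (Fin 2) (Fin 2) ℂ), X ∉ C' → f (q, X) = 0)
    (hZ : ∀ ξ : P, (∀ X, Θ (ξ, X) = 0) → ∀ (cw : Fin 3 → ℝ) (X : Matrix (Fin 2) (Fin 2) ℂ), f ((ξ, cw), X) = 0)
    (hI : ∀ (ξ : P), ∀ cw ∈ U, Function.Injective (fun i : Fin 3 => Circle.exp (cw i)) →
      ∫ g : ↥(archLocal L 3 (Matrix.diagonal α) w),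
          Θ (ξ, (((g * gprimeBlockAt L α w S' cw * g⁻¹ : ↥(archLocal L 3 (Matrix.diagonal α) w)) : GL (Fin 3) ℂ) : Matrix (Fin 3) (Fin 3) ℂ)) ∂νw =
        K * ∫ h : ↥(unitaryGroupOfForm (starRingEnd ℂ) J),
          f ((ξ, cw), (((h * ⟨Matrix.GeneralLinearGroup.mkOfDetNeZero !![(1 : ℂ), 1; 1, -1] det_cayleyTwo_ne_zero *
              circleDiagonal 2 ![Circle.exp (cw 0), Circle.exp (cw 2)] *
              (Matrix.GeneralLinearGroup.mkOfDetNeZero !![(1 : ℂ), 1; 1, -1] det_cayleyTwo_ne_zero)⁻¹, cayley_conj_circleDiagonal_mem_of_eq_over hJ _⟩ * h⁻¹ :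
            ↥(unitaryGroupOfForm (starRingEnd ℂ) J)) : GL (Fin 2) ℂ) : Matrix (Fin 2) (Fin 2) ℂ)) ∂μ₀) :
    ∃ (K' : ℝ) (U' : Set (Fin 3 → ℝ)) (f' : (P × (Fin 3 → ℝ)) × Matrix (Fin 2) (Fin 2) ℂ → ℂ) (C'' : Set (Matrix (Fin 2) (Fin 2) ℂ)),
      K' ≠ 0 ∧ IsOpen U' ∧ pw ∈ U' ∧ ContDiff ℝ ∞ f' ∧ IsCompact C'' ∧ (∀ (q : P × (Fin 3 → ℝ)) (X : Matrix (Fin 2) (Fin 2) ℂ), X ∉ C'' → f' (q, X) = 0) ∧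
      (∀ ξ : P, (∀ X, Θ (ξ, X) = 0) → ∀ (cw : Fin 3 → ℝ) (X : Matrix (Fin 2) (Fin 2) ℂ), f' ((ξ, cw), X) = 0) ∧
      ∀ (ξ : P) (cw : Fin 3 → ℝ), cw ∈ U' → Function.Injective (fun i : Fin 3 => Circle.exp (cw i)) →
        ∫ g : ↥(archLocal L 3 (Matrix.diagonal α) w),
            Θ (ξ, (((g * gprimeBlockAt L α w S' cw * g⁻¹ : ↥(archLocal L 3 (Matrix.diagonal α) w)) : GL (Fin 3) ℂ) : Matrix (Fin 3) (Fin 3) ℂ)) ∂νw =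
          K' • ∫ h : ↥(unitaryGroupOfForm (starRingEnd ℂ) J),
            f' ((ξ, cw), (((h * ⟨Matrix.GeneralLinearGroup.mkOfDetNeZero !![(1 : ℂ), 1; 1, -1] det_cayleyTwo_ne_zero *
                circleDiagonal 2 ![Circle.exp ((cw 0 - cw 2) / 2), Circle.exp (-((cw 0 - cw 2) / 2))] *
                (Matrix.GeneralLinearGroup.mkOfDetNeZero !![(1 : ℂ), 1; 1, -1] det_cayleyTwo_ne_zero)⁻¹, cayley_conj_circleDiagonal_mem_of_eq_over hJ _⟩ * h⁻¹ :
              ↥(unitaryGroupOfForm (starRingEnd ℂ) J)) : GL (Fin 2) ℂ) : Matrix (Fin 2) (Fin 2) ℂ)) ∂μ₀ := by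
  -- the centre phase `ζ(cw) = e^{i(cw₀+cw₂)/2}` as a smooth complex-valued function of `cw`
  have hζ : ContDiff ℝ ∞ fun cw : Fin 3 → ℝ => ((Circle.exp ((cw 0 + cw 2) / 2) : Circle) : ℂ) := by
    have h1 : ContDiff ℝ ∞ fun cw : Fin 3 → ℝ => (cw 0 + cw 2) / 2 :=
      ((contDiff_apply ℝ ℝ (0 : Fin 3)).add (contDiff_apply ℝ ℝ (2 : Fin 3))).div_const _
    have h2 : ContDiff ℝ ∞ fun t : ℝ => ((Circle.exp t : Circle) : ℂ) := by
      simp only [Circle.coe_exp]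
      exact Complex.contDiff_exp.comp ((Complex.ofRealCLM.contDiff).mul contDiff_const)
    exact h2.comp h1
  -- the witnesses
  refine ⟨1, U, fun q => K * f (q.1, ((Circle.exp ((q.1.2 0 + q.1.2 2) / 2) : Circle) : ℂ) • q.2),
    (fun p : Circle × Matrix (Fin 2) (Fin 2) ℂ => ((p.1⁻¹ : Circle) : ℂ) • p.2) '' (univ ×ˢ C'),
    one_ne_zero, hU, hpw, ?_, ?_, ?_, ?_, ?_⟩
  · -- smoothness of `f′`
    refine contDiff_const.mul (hf.comp (contDiff_fst.prodMk ?_))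
    exact ((hζ.comp (contDiff_snd.comp contDiff_fst)).smul contDiff_snd)
  · -- `C″` is compact
    have hinv : Continuous fun z : Circle => ((z⁻¹ : Circle) : ℂ) := continuous_subtype_val.comp (continuous_inv : Continuous fun z : Circle => z⁻¹)
    exact ((isCompact_univ (X := Circle)).prod hC').image ((hinv.comp continuous_fst).smul continuous_snd)
  · -- one compact support for `f′`
    intro q X hX
    have hmem : ((Circle.exp ((q.2 0 + q.2 2) / 2) : Circle) : ℂ) • X ∉ C' := fun hmem =>
      hX ⟨(Circle.exp ((q.2 0 + q.2 2) / 2), ((Circle.exp ((q.2 0 + q.2 2) / 2) : Circle) : ℂ) • X), ⟨mem_univ _, hmem⟩, by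
        simp only [smul_smul, Circle.coe_inv, inv_mul_cancel₀ (Circle.coe_ne_zero _), one_smul]⟩
    show K * f (q, ((Circle.exp ((q.2 0 + q.2 2) / 2) : Circle) : ℂ) • X) = 0
    rw [hfC' q _ hmem, mul_zero]
  · -- zero propagation
    intro ξ hξ cw X
    show K * f ((ξ, cw), ((Circle.exp ((cw 0 + cw 2) / 2) : Circle) : ℂ) • X) = 0
    rw [hZ ξ hξ cw _, mul_zero]
  · -- the identity: centre absorption on the Cayley torus
    intro ξ cw hcw hinj
    rw [hI ξ cw hcw hinj, one_smul, ← integral_const_mul]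
    refine integral_congr_ae (Eventually.of_forall fun h => ?_)
    show K * f ((ξ, cw), _) = K * f ((ξ, cw), ((Circle.exp ((cw 0 + cw 2) / 2) : Circle) : ℂ) • _)
    rw [smul_coe_conj_cayleyTorus hJ h]
    have hvec : (fun i : Fin 2 => Circle.exp ((cw 0 + cw 2) / 2) * (![Circle.exp ((cw 0 - cw 2) / 2), Circle.exp (-((cw 0 - cw 2) / 2))] i)) =
        ![Circle.exp (cw 0), Circle.exp (cw 2)] := by
      funext i
      fin_cases i
      · simp only [Fin.zero_eta, Fin.isValue, Matrix.cons_val_zero, ← Circle.exp_add]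
        congr 1
        ring
      · simp only [Fin.mk_one, Fin.isValue, Matrix.cons_val_one, Matrix.cons_val_fin_one, ← Circle.exp_add]
        congr 1
        ring
    have hT : (⟨Matrix.GeneralLinearGroup.mkOfDetNeZero !![(1 : ℂ), 1; 1, -1] det_cayleyTwo_ne_zero *
          circleDiagonal 2 (fun i : Fin 2 => Circle.exp ((cw 0 + cw 2) / 2) * (![Circle.exp ((cw 0 - cw 2) / 2), Circle.exp (-((cw 0 - cw 2) / 2))] i)) *
          (Matrix.GeneralLinearGroup.mkOfDetNeZero !![(1 : ℂ), 1; 1, -1] det_cayleyTwo_ne_zero)⁻¹, cayley_conj_circleDiagonal_mem_of_eq_over hJ _⟩ :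
          ↥(unitaryGroupOfForm (starRingEnd ℂ) J)) =
        ⟨Matrix.GeneralLinearGroup.mkOfDetNeZero !![(1 : ℂ), 1; 1, -1] det_cayleyTwo_ne_zero * circleDiagonal 2 ![Circle.exp (cw 0), Circle.exp (cw 2)] *
          (Matrix.GeneralLinearGroup.mkOfDetNeZero !![(1 : ℂ), 1; 1, -1] det_cayleyTwo_ne_zero)⁻¹, cayley_conj_circleDiagonal_mem_of_eq_over hJ _⟩ := Subtype.ext (by rw [hvec])
    rw [hT]

end Adapter

end Literature.NumberTheory.Rogawski1990

end
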